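import Summits.KontsevichZagierPeriods.KontsevichZagierPeriods.Theorems.UnfoldedStokesUnfoldedStokesSquareField

/-!
# Route KontsevichZagierPeriods/UnfoldedStokes — crux `UnfoldedStokesSquare`, part 2/3: regularity and divergence

Problem `KontsevichZagierPeriods`, route `UnfoldedStokes`, item stmt-KontsevichZagierPeriods-3520
(`UnfoldedStokesSquare`, crux, rank 2): the unfolded Stokes relator of the unit square lies in
`KZ.relations`.  Data: `U ⊇ [0,1]²` open and star-shaped about `0`; `a, b, c, e` of class `C¹` and
`ℚ`-semialgebraic on `U` (with the five first partials that occur also semialgebraic), the 1-form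
`ω = a ds + b dt` closed (`∂ₜa = ∂ₛb`).  With `Ω(s,t,u) = s·a(us,ut) + t·b(us,ut)` the combination
`[rB] + [rR] − [rT] − [rL] − [rW] − [rD]` of the four edge representations, the wedge representation
`rW = [D, ae − bc]` and the bulk representation `rD = [D×(0,1), Ω·(∂ₛe − ∂ₜc)]` is a KZ relation.

Line `divergence-engine-transport` (crux idea card of the same name; skeleton `SketchIdeator1.lean`
of the crux work directory, landed against the route declaration BY NAME): the crux is ONE
instance (`k = 2`) of the move-level divergence theorem on the open cube already proved in the tree
for crux `DihedralNormalForm` of route `LinRedNormalForm`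
(`TameBVStokes.stub_boundedStokesMove`, its bounded-variation hypothesis discharged by
`TameBVStokes.stub_bvStokes`; both sorry-free `Theorems` files), applied to the HOMOTOPY VECTOR FIELD
`G = (Ω·e, −Ω·c, −(u·a(up)·e − u·b(up)·c))` on `(0,1)³`: its flux through the six faces is
`rR, rL, −rT, −rB, −rW, 0` and its divergence is `rD`'s integrand `Ω·(∂ₛe − ∂ₜc)` — the closedness
`∂ₜa = ∂ₛb` enters ONLY through this pointwise identity, via the Literature lemmas
`KZ.UnfoldedStokesData.hasDerivAt_unfolding_insertNth` (closedness unfolded: `∂ⱼΩ = ∂ᵤ(u·aⱼ(up))`)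
and `KZ.UnfoldedStokesData.hasDerivAt_mul_a_smul` (the radial derivative).

The proof is split by topic over three files:
* `UnfoldedStokesUnfoldedStokesSquareField`  — §0 the engine (`divergenceEngine` =
  `stub_boundedStokesMove stub_bvStokes`) and its literal-index form in dimension 3
  (`divergenceEngine₃`); §1 the field (`dil`, `proj`, `Omega`, `fieldS/T/U`) and polynomial-map
  facts; S1 `stub_fieldSemialgebraic` (composition with polynomial maps into the star-shaped `U`);
  §3 the six face identities;
* `UnfoldedStokesUnfoldedStokesSquareStubs`  — S2 `stub_fieldRegular` (bounded / differentiable /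
  fibre-continuous) and S3 `stub_fieldDiv` (the divergence identity, where closedness acts);
* `UnfoldedStokesUnfoldedStokesSquare`       — §4 the assembly (engine + `[r] + [r.neg] ∈ relations`,
  `[0] ∈ relations`, `abel`): `unfoldedStokesSquare_proof : …Theses.UnfoldedStokes.UnfoldedStokesSquare`.

Sources: M. Kontsevich, D. Zagier, *Periods* (2001), §1.2 (the Stokes rule); R. Bott, L. Tu,
*Differential Forms in Algebraic Topology* (1982), §4 (homotopy operator of the Poincaré lemma);
P. Griffiths, J. Harris, *Principles of Algebraic Geometry* (1978), Ch. 0 (Stokes on a cell).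
-/

noncomputable section

open MeasureTheory Set
open Literature.NumberTheory.Transcendental
open Literature.ModelTheory.ExponentialFields (IsSemialgebraic)

namespace Summit.KontsevichZagierPeriods.UnfoldedStokes.UnfoldedStokesSquare

variable (U : Set (Fin 2 → ℝ)) (a b c e : (Fin 2 → ℝ) → ℝ)

/-! ## 2 (continued). Stubs S2 and S3 of the line -/

/-- A path `t ↦ ![f t, g t, h t]` with continuous components is continuous. -/
private theorem continuous_vec3 {f g h : ℝ → ℝ} (hf : Continuous f) (hg : Continuous g)
    (hh : Continuous h) : Continuous fun t => (![f t, g t, h t] : Fin 3 → ℝ) :=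
  continuous_pi fun j => by
    fin_cases j
    · exact hf
    · exact hg
    · exact hh

/-- S2: regularity — bounded on the open cube, differentiable there, continuous on each closed
coordinate fibre (the data are `C¹` on the open `U ⊇ [0,1]²`, star-shaped about `0`). -/
theorem stub_fieldRegular (hU : IsOpen U) (hUI : Icc (0 : Fin 2 → ℝ) 1 ⊆ U)
    (hstar : ∀ p ∈ U, ∀ u ∈ Icc (0 : ℝ) 1, u • p ∈ U)
    (ha : ContDiffOn ℝ 1 a U) (hb : ContDiffOn ℝ 1 b U) (hc : ContDiffOn ℝ 1 c U)
    (he : ContDiffOn ℝ 1 e U) :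
    (∃ C : ℝ, (∀ x ∈ {x : Fin 3 → ℝ | ∀ i, x i ∈ Ioo (0 : ℝ) 1}, |fieldS a b e x| ≤ C) ∧
      (∀ x ∈ {x : Fin 3 → ℝ | ∀ i, x i ∈ Ioo (0 : ℝ) 1}, |fieldT a b c x| ≤ C) ∧
      (∀ x ∈ {x : Fin 3 → ℝ | ∀ i, x i ∈ Ioo (0 : ℝ) 1}, |fieldU a b c e x| ≤ C)) ∧
    ((∀ x ∈ {x : Fin 3 → ℝ | ∀ i, x i ∈ Ioo (0 : ℝ) 1}, DifferentiableAt ℝ (fieldS a b e) x) ∧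
      (∀ x ∈ {x : Fin 3 → ℝ | ∀ i, x i ∈ Ioo (0 : ℝ) 1}, DifferentiableAt ℝ (fieldT a b c) x) ∧
      (∀ x ∈ {x : Fin 3 → ℝ | ∀ i, x i ∈ Ioo (0 : ℝ) 1}, DifferentiableAt ℝ (fieldU a b c e) x)) ∧
    ((∀ y ∈ {x : Fin 2 → ℝ | ∀ i, x i ∈ Ioo (0 : ℝ) 1},
        ContinuousOn (fun t : ℝ => fieldS a b e (Fin.insertNth 0 t y)) (Icc 0 1)) ∧
      (∀ y ∈ {x : Fin 2 → ℝ | ∀ i, x i ∈ Ioo (0 : ℝ) 1},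
        ContinuousOn (fun t : ℝ => fieldT a b c (Fin.insertNth 1 t y)) (Icc 0 1)) ∧
      (∀ y ∈ {x : Fin 2 → ℝ | ∀ i, x i ∈ Ioo (0 : ℝ) 1},
        ContinuousOn (fun t : ℝ => fieldU a b c e (Fin.insertNth 2 t y)) (Icc 0 1))) := by
  set Q3 : Set (Fin 3 → ℝ) := {x : Fin 3 → ℝ | ∀ i, x i ∈ Icc (0 : ℝ) 1} with hQ3
  have mdil : MapsTo dil Q3 U := fun x hx => dil_mem hUI hstar hx
  have mproj : MapsTo proj Q3 U := fun x hx => proj_mem hUI hx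
  have continuous_proj : Continuous proj :=
    continuous_pi fun j => by
      fin_cases j
      · exact continuous_apply 0
      · exact continuous_apply 1
  -- continuity on the closed cube
  have caD : ContinuousOn (fun x => a (dil x)) Q3 := ha.continuousOn.comp continuous_dil.continuousOn mdil
  have cbD : ContinuousOn (fun x => b (dil x)) Q3 := hb.continuousOn.comp continuous_dil.continuousOn mdil
  have ccP : ContinuousOn (fun x => c (proj x)) Q3 := hc.continuousOn.comp continuous_proj.continuousOn mproj
  have ceP : ContinuousOn (fun x => e (proj x)) Q3 := he.continuousOn.comp continuous_proj.continuousOn mproj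
  have c0 : ContinuousOn (fun x : Fin 3 → ℝ => x 0) Q3 := (continuous_apply 0).continuousOn
  have c1 : ContinuousOn (fun x : Fin 3 → ℝ => x 1) Q3 := (continuous_apply 1).continuousOn
  have c2 : ContinuousOn (fun x : Fin 3 → ℝ => x 2) Q3 := (continuous_apply 2).continuousOn
  have cΩ : ContinuousOn (Omega a b) Q3 := (c0.mul caD).add (c1.mul cbD)
  have cS : ContinuousOn (fieldS a b e) Q3 := cΩ.mul ceP
  have cT : ContinuousOn (fieldT a b c) Q3 := (cΩ.mul ccP).neg
  have cU : ContinuousOn (fieldU a b c e) Q3 := (((c2.mul caD).mul ceP).sub ((c2.mul cbD).mul ccP)).neg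
  -- bounds
  obtain ⟨C₀, hC₀⟩ := isCompact_Q3.exists_bound_of_continuousOn cS
  obtain ⟨C₁, hC₁⟩ := isCompact_Q3.exists_bound_of_continuousOn cT
  obtain ⟨C₂, hC₂⟩ := isCompact_Q3.exists_bound_of_continuousOn cU
  refine ⟨⟨max C₀ (max C₁ C₂), fun x hx => ?_, fun x hx => ?_, fun x hx => ?_⟩, ⟨?_, ?_, ?_⟩,
    ⟨?_, ?_, ?_⟩⟩
  · have h := hC₀ x (Icc_of_Ioo hx)
    rw [Real.norm_eq_abs] at h
    exact h.trans (le_max_left _ _)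
  · have h := hC₁ x (Icc_of_Ioo hx)
    rw [Real.norm_eq_abs] at h
    exact h.trans (le_max_of_le_right (le_max_left _ _))
  · have h := hC₂ x (Icc_of_Ioo hx)
    rw [Real.norm_eq_abs] at h
    exact h.trans (le_max_of_le_right (le_max_right _ _))
  -- differentiability on the open cube
  · intro x hx
    have hdx : dil x ∈ U := mdil (Icc_of_Ioo hx)
    have hpx : proj x ∈ U := mproj (Icc_of_Ioo hx)
    have daD : DifferentiableAt ℝ (fun x => a (dil x)) x :=
      (((ha.differentiableOn one_ne_zero) _ hdx).differentiableAt (hU.mem_nhds hdx)).comp x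
        (differentiable_dil x)
    have dbD : DifferentiableAt ℝ (fun x => b (dil x)) x :=
      (((hb.differentiableOn one_ne_zero) _ hdx).differentiableAt (hU.mem_nhds hdx)).comp x
        (differentiable_dil x)
    have deP : DifferentiableAt ℝ (fun x => e (proj x)) x :=
      (((he.differentiableOn one_ne_zero) _ hpx).differentiableAt (hU.mem_nhds hpx)).comp x
        (differentiable_proj x)
    have d0 : DifferentiableAt ℝ (fun x : Fin 3 → ℝ => x 0) x := by fun_prop
    have d1 : DifferentiableAt ℝ (fun x : Fin 3 → ℝ => x 1) x := by fun_prop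
    exact ((d0.mul daD).add (d1.mul dbD)).mul deP
  · intro x hx
    have hdx : dil x ∈ U := mdil (Icc_of_Ioo hx)
    have hpx : proj x ∈ U := mproj (Icc_of_Ioo hx)
    have daD : DifferentiableAt ℝ (fun x => a (dil x)) x :=
      (((ha.differentiableOn one_ne_zero) _ hdx).differentiableAt (hU.mem_nhds hdx)).comp x
        (differentiable_dil x)
    have dbD : DifferentiableAt ℝ (fun x => b (dil x)) x :=
      (((hb.differentiableOn one_ne_zero) _ hdx).differentiableAt (hU.mem_nhds hdx)).comp x
        (differentiable_dil x)
    have dcP : DifferentiableAt ℝ (fun x => c (proj x)) x :=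
      (((hc.differentiableOn one_ne_zero) _ hpx).differentiableAt (hU.mem_nhds hpx)).comp x
        (differentiable_proj x)
    have d0 : DifferentiableAt ℝ (fun x : Fin 3 → ℝ => x 0) x := by fun_prop
    have d1 : DifferentiableAt ℝ (fun x : Fin 3 → ℝ => x 1) x := by fun_prop
    exact (((d0.mul daD).add (d1.mul dbD)).mul dcP).neg
  · intro x hx
    have hdx : dil x ∈ U := mdil (Icc_of_Ioo hx)
    have hpx : proj x ∈ U := mproj (Icc_of_Ioo hx)
    have daD : DifferentiableAt ℝ (fun x => a (dil x)) x :=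
      (((ha.differentiableOn one_ne_zero) _ hdx).differentiableAt (hU.mem_nhds hdx)).comp x
        (differentiable_dil x)
    have dbD : DifferentiableAt ℝ (fun x => b (dil x)) x :=
      (((hb.differentiableOn one_ne_zero) _ hdx).differentiableAt (hU.mem_nhds hdx)).comp x
        (differentiable_dil x)
    have dcP : DifferentiableAt ℝ (fun x => c (proj x)) x :=
      (((hc.differentiableOn one_ne_zero) _ hpx).differentiableAt (hU.mem_nhds hpx)).comp x
        (differentiable_proj x)
    have deP : DifferentiableAt ℝ (fun x => e (proj x)) x :=
      (((he.differentiableOn one_ne_zero) _ hpx).differentiableAt (hU.mem_nhds hpx)).comp x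
        (differentiable_proj x)
    have d2 : DifferentiableAt ℝ (fun x : Fin 3 → ℝ => x 2) x := by fun_prop
    exact (((d2.mul daD).mul deP).sub ((d2.mul dbD).mul dcP)).neg
  -- continuity on the closed coordinate fibres
  · intro y hy
    have hpath : Continuous fun t : ℝ => (Fin.insertNth (0 : Fin 3) t y : Fin 3 → ℝ) := by
      simp only [Beukers.insertNth_zero_eq]; exact continuous_vec3 continuous_id continuous_const continuous_const
    refine cS.comp hpath.continuousOn fun t ht => ?_
    rw [Beukers.insertNth_zero_eq]
    intro i
    fin_cases i
    · exact ht
    · exact Ioo_subset_Icc_self (hy 0)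
    · exact Ioo_subset_Icc_self (hy 1)
  · intro y hy
    have hpath : Continuous fun t : ℝ => (Fin.insertNth (1 : Fin 3) t y : Fin 3 → ℝ) := by
      simp only [Beukers.insertNth_one_eq]; exact continuous_vec3 continuous_const continuous_id continuous_const
    refine cT.comp hpath.continuousOn fun t ht => ?_
    rw [Beukers.insertNth_one_eq]
    intro i
    fin_cases i
    · exact Ioo_subset_Icc_self (hy 0)
    · exact ht
    · exact Ioo_subset_Icc_self (hy 1)
  · intro y hy
    have hpath : Continuous fun t : ℝ => (Fin.insertNth (2 : Fin 3) t y : Fin 3 → ℝ) := by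
      simp only [Beukers.insertNth_two_eq]; exact continuous_vec3 continuous_const continuous_const continuous_id
    refine cU.comp hpath.continuousOn fun t ht => ?_
    rw [Beukers.insertNth_two_eq]
    intro i
    fin_cases i
    · exact Ioo_subset_Icc_self (hy 0)
    · exact Ioo_subset_Icc_self (hy 1)
    · exact ht

/-! ### Shape lemmas (vector notation on `Fin 2`/`Fin 3`, sums over `Fin (1+1)`) -/

/-- A sum over `Fin (1+1)` written out with literal indices. -/
private theorem sum_two' {M : Type*} [AddCommMonoid M] (f : Fin (1 + 1) → M) :
    ∑ j, f j = f (0 : Fin 2) + f (1 : Fin 2) := Fin.sum_univ_two f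

/-- `Fin.insertNth 0` on `Fin 2` in vector notation. -/
private theorem ins0 (t q : ℝ) : (Fin.insertNth (0 : Fin 2) t ![q] : Fin 2 → ℝ) = ![t, q] := by
  ext j; fin_cases j <;> rfl

/-- `Fin.insertNth 1` on `Fin 2` in vector notation. -/
private theorem ins1 (t q : ℝ) : (Fin.insertNth (1 : Fin 2) t ![q] : Fin 2 → ℝ) = ![q, t] := by
  ext j; fin_cases j <;> rfl

/-- `Function.update · 0` on `Fin 3` in vector notation. -/
private theorem update0 (x : Fin 3 → ℝ) (s : ℝ) : Function.update x 0 s = ![s, x 1, x 2] := by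
  ext j; fin_cases j <;> rfl

/-- `Function.update · 1` on `Fin 3` in vector notation. -/
private theorem update1 (x : Fin 3 → ℝ) (s : ℝ) : Function.update x 1 s = ![x 0, s, x 2] := by
  ext j; fin_cases j <;> rfl

/-- `Function.update · 2` on `Fin 3` in vector notation. -/
private theorem update2 (x : Fin 3 → ℝ) (s : ℝ) : Function.update x 2 s = ![x 0, x 1, s] := by
  ext j; fin_cases j <;> rfl

/-- `Function.update (proj x) 0` in vector notation. -/
private theorem update0_proj (x : Fin 3 → ℝ) (s : ℝ) : Function.update (proj x) 0 s = ![s, x 1] := by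
  ext j; fin_cases j <;> rfl

/-- `Function.update (proj x) 1` in vector notation. -/
private theorem update1_proj (x : Fin 3 → ℝ) (s : ℝ) : Function.update (proj x) 1 s = ![x 0, s] := by
  ext j; fin_cases j <;> rfl

/-- S3 (the heart): `div G = Ω·(∂ₛe − ∂ₜc)` on the open cube — the closedness `∂ₜa = ∂ₛb` turns
`∂ₛΩ`, `∂ₜΩ` into the radial derivatives `∂ᵤ(u·a(up))`, `∂ᵤ(u·b(up))`, which the `u`-component cancels
(`KZ.UnfoldedStokesData.hasDerivAt_unfolding_insertNth`, `hasDerivAt_mul_a_smul`). The semialgebraic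
hypotheses are only used to instantiate the packaged datum `KZ.UnfoldedStokesData.square`. -/
theorem stub_fieldDiv (hU : IsOpen U) (hUI : Icc (0 : Fin 2 → ℝ) 1 ⊆ U)
    (hstar : ∀ p ∈ U, ∀ u ∈ Icc (0 : ℝ) 1, u • p ∈ U)
    (ha : ContDiffOn ℝ 1 a U) (hb : ContDiffOn ℝ 1 b U) (hc : ContDiffOn ℝ 1 c U)
    (he : ContDiffOn ℝ 1 e U)
    (hclosed : ∀ p ∈ U, fderiv ℝ a p (Pi.single 1 1) = fderiv ℝ b p (Pi.single 0 1))
    (sa : IsSemialgebraicFunOn ℚ U a) (sb : IsSemialgebraicFunOn ℚ U b)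
    (sc : IsSemialgebraicFunOn ℚ U c) (se : IsSemialgebraicFunOn ℚ U e)
    (sa₀ : IsSemialgebraicFunOn ℚ U fun p => fderiv ℝ a p (Pi.single 0 1))
    (sa₁ : IsSemialgebraicFunOn ℚ U fun p => fderiv ℝ a p (Pi.single 1 1))
    (sb₁ : IsSemialgebraicFunOn ℚ U fun p => fderiv ℝ b p (Pi.single 1 1))
    (sc₁ : IsSemialgebraicFunOn ℚ U fun p => fderiv ℝ c p (Pi.single 1 1))
    (se₀ : IsSemialgebraicFunOn ℚ U fun p => fderiv ℝ e p (Pi.single 0 1)) :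
    ∀ x ∈ {x : Fin 3 → ℝ | ∀ i, x i ∈ Ioo (0 : ℝ) 1},
      fderiv ℝ (fieldS a b e) x (Pi.single 0 1) + fderiv ℝ (fieldT a b c) x (Pi.single 1 1) +
          fderiv ℝ (fieldU a b c e) x (Pi.single 2 1) =
        Omega a b x * (fderiv ℝ e (proj x) (Pi.single 0 1) - fderiv ℝ c (proj x) (Pi.single 1 1)) := by
  intro x hx
  -- the packaged datum of the square (carries the closedness in the form the tree lemmas consume)
  let D : KZ.UnfoldedStokesData 1 :=
    KZ.UnfoldedStokesData.square hU hUI hstar ha hb hc he hclosed sa sb sc se sa₀ sa₁ sb₁ sc₁ se₀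
  have hDa0 : D.a (0 : Fin 2) = a := rfl
  have hDa1 : D.a (1 : Fin 2) = b := rfl
  -- the two points `p = (s,t)` and `u p`
  have hxI : ∀ i, x i ∈ Icc (0 : ℝ) 1 := Icc_of_Ioo hx
  have hp : proj x ∈ U := proj_mem hUI hxI
  have hd : dil x ∈ U := dil_mem hUI hstar hxI
  have hsp : x 2 • proj x ∈ U := by rw [← dil_eq_smul_proj]; exact hd
  have hins₀ : (Fin.insertNth (0 : Fin 2) (x 0) ![x 1] : Fin 2 → ℝ) = proj x := by
    ext j; fin_cases j <;> rfl
  have hins₁ : (Fin.insertNth (1 : Fin 2) (x 1) ![x 0] : Fin 2 → ℝ) = proj x := by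
    ext j; fin_cases j <;> rfl
  have hupd0 : Function.update (proj x) 0 (x 0) = proj x := by ext j; fin_cases j <;> rfl
  have hupd1 : Function.update (proj x) 1 (x 1) = proj x := by ext j; fin_cases j <;> rfl
  -- differentiability of the three components at `x` (stub S2) and of `e`, `c` at `p`
  obtain ⟨-, ⟨hdS, hdT, hdU⟩, -⟩ := stub_fieldRegular U a b c e hU hUI hstar ha hb hc he
  have He : HasFDerivAt e (fderiv ℝ e (proj x)) (proj x) :=
    (((he.differentiableOn one_ne_zero) _ hp).differentiableAt (hU.mem_nhds hp)).hasFDerivAt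
  have Hc : HasFDerivAt c (fderiv ℝ c (proj x)) (proj x) :=
    (((hc.differentiableOn one_ne_zero) _ hp).differentiableAt (hU.mem_nhds hp)).hasFDerivAt
  -- `Ω(p, u) = unfolding` of the datum
  have hunf : KZ.unfolding D.a (proj x) (x 2) = Omega a b x := by
    rw [KZ.unfolding_apply, sum_two']
    simp only [hDa0, hDa1, proj, Omega, dil, Matrix.cons_val_zero, Matrix.cons_val_one,
      Matrix.smul_cons, Matrix.smul_empty, smul_eq_mul]
  ----------------------------------------------------------------
  -- (1) `∂ₛ G₀ = (a(up) + u·Da(up)·p)·e(p) + Ω·∂ₛe(p)`  (closedness, unfolded, along `s`)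
  ----------------------------------------------------------------
  have key0 := D.hasDerivAt_unfolding_insertNth (0 : Fin 2) ![x 1] (x 2) (x 0)
    (by rw [hins₀]; exact hsp)
  have hE : HasDerivAt (fun s => e (Function.update (proj x) 0 s))
      (fderiv ℝ e (proj x) (Pi.single 0 1)) (x 0) := by
    have He' : HasFDerivAt e (fderiv ℝ e (proj x)) (Function.update (proj x) 0 (x 0)) := by
      rw [hupd0]; exact He
    exact He'.comp_hasDerivAt (x 0) (hasDerivAt_update (proj x) 0 (x 0))
  have hpt0 : ∀ s, fieldS a b e (Function.update x 0 s) =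
      KZ.unfolding D.a (Fin.insertNth (0 : Fin 2) s ![x 1]) (x 2) * e (Function.update (proj x) 0 s) := by
    intro s
    rw [update0, ins0, update0_proj, KZ.unfolding_apply, sum_two']
    simp only [fieldS, Omega, dil, proj, hDa0, hDa1, Matrix.cons_val_zero, Matrix.cons_val_one,
      Matrix.head_cons, Matrix.cons_val_two, Matrix.tail_cons, Matrix.smul_cons, Matrix.smul_empty,
      smul_eq_mul]
  have hcalc0 := (key0.mul hE).congr_of_eventuallyEq (Filter.Eventually.of_forall hpt0)
  have hcomp0 : HasDerivAt (fun s => fieldS a b e (Function.update x 0 s))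
      (fderiv ℝ (fieldS a b e) x (Pi.single 0 1)) (x 0) := by
    have hF : HasFDerivAt (fieldS a b e) (fderiv ℝ (fieldS a b e) x) (Function.update x 0 (x 0)) := by
      rw [Function.update_eq_self]; exact (hdS x hx).hasFDerivAt
    exact hF.comp_hasDerivAt (x 0) (hasDerivAt_update x 0 (x 0))
  have e0 := hcomp0.unique hcalc0
  ----------------------------------------------------------------
  -- (2) `∂ₜ G₁ = −[(b(up) + u·Db(up)·p)·c(p) + Ω·∂ₜc(p)]`  (closedness, unfolded, along `t`)
  ----------------------------------------------------------------
  have key1 := D.hasDerivAt_unfolding_insertNth (1 : Fin 2) ![x 0] (x 2) (x 1)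
    (by rw [hins₁]; exact hsp)
  have hC : HasDerivAt (fun s => c (Function.update (proj x) 1 s))
      (fderiv ℝ c (proj x) (Pi.single 1 1)) (x 1) := by
    have Hc' : HasFDerivAt c (fderiv ℝ c (proj x)) (Function.update (proj x) 1 (x 1)) := by
      rw [hupd1]; exact Hc
    exact Hc'.comp_hasDerivAt (x 1) (hasDerivAt_update (proj x) 1 (x 1))
  have hpt1 : ∀ s, fieldT a b c (Function.update x 1 s) =
      -(KZ.unfolding D.a (Fin.insertNth (1 : Fin 2) s ![x 0]) (x 2) * c (Function.update (proj x) 1 s)) := by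
    intro s
    rw [update1, ins1, update1_proj, KZ.unfolding_apply, sum_two']
    simp only [fieldT, Omega, dil, proj, hDa0, hDa1, Matrix.cons_val_zero, Matrix.cons_val_one,
      Matrix.head_cons, Matrix.cons_val_two, Matrix.tail_cons, Matrix.smul_cons, Matrix.smul_empty,
      smul_eq_mul]
  have hcalc1 := (key1.mul hC).neg.congr_of_eventuallyEq (Filter.Eventually.of_forall hpt1)
  have hcomp1 : HasDerivAt (fun s => fieldT a b c (Function.update x 1 s))
      (fderiv ℝ (fieldT a b c) x (Pi.single 1 1)) (x 1) := by
    have hF : HasFDerivAt (fieldT a b c) (fderiv ℝ (fieldT a b c) x) (Function.update x 1 (x 1)) := by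
      rw [Function.update_eq_self]; exact (hdT x hx).hasFDerivAt
    exact hF.comp_hasDerivAt (x 1) (hasDerivAt_update x 1 (x 1))
  have e1 := hcomp1.unique hcalc1
  ----------------------------------------------------------------
  -- (3) `∂ᵤ G₂ = −[(a(up) + u·Da(up)·p)·e(p) − (b(up) + u·Db(up)·p)·c(p)]`  (radial derivatives)
  ----------------------------------------------------------------
  have keyA := D.hasDerivAt_mul_a_smul (0 : Fin 2) (proj x) (u := x 2) hsp
  have keyB := D.hasDerivAt_mul_a_smul (1 : Fin 2) (proj x) (u := x 2) hsp
  have hpt2 : ∀ v, fieldU a b c e (Function.update x 2 v) =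
      -(v * D.a (0 : Fin 2) (v • proj x) * e (proj x) - v * D.a (1 : Fin 2) (v • proj x) * c (proj x)) := by
    intro v
    rw [update2]
    simp only [fieldU, dil, proj, hDa0, hDa1, Matrix.cons_val_zero, Matrix.cons_val_one,
      Matrix.head_cons, Matrix.cons_val_two, Matrix.tail_cons, Matrix.smul_cons, Matrix.smul_empty,
      smul_eq_mul]
  have hcalc2 := ((keyA.mul_const (e (proj x))).sub (keyB.mul_const (c (proj x)))).neg.congr_of_eventuallyEq
    (Filter.Eventually.of_forall hpt2)
  have hcomp2 : HasDerivAt (fun v => fieldU a b c e (Function.update x 2 v))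
      (fderiv ℝ (fieldU a b c e) x (Pi.single 2 1)) (x 2) := by
    have hF : HasFDerivAt (fieldU a b c e) (fderiv ℝ (fieldU a b c e) x) (Function.update x 2 (x 2)) := by
      rw [Function.update_eq_self]; exact (hdU x hx).hasFDerivAt
    exact hF.comp_hasDerivAt (x 2) (hasDerivAt_update x 2 (x 2))
  have e2 := hcomp2.unique hcalc2
  ----------------------------------------------------------------
  -- sum: the radial terms cancel (this is where closedness has acted), leaving `Ω·(∂ₛe − ∂ₜc)`
  ----------------------------------------------------------------
  rw [e0, e1, e2, hins₀, hins₁, hupd0, hupd1, hunf]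
  ring

end Summit.KontsevichZagierPeriods.UnfoldedStokes.UnfoldedStokesSquare

end
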